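import Literature.Barriers.AtomisticToContinuum.OneDimensionalHardCoreBands
import HarnessLib

/-!
# No generalised condensation of van den Berg–Lewis–Pulé type in Girardeau's gas

Nineteenth audit (2026-08-17) of the barrier entry
`Literature.Barriers.AtomisticToContinuum.OneDimensionalHardCore`; theorems only (no definition,
no named fact).

The band law of the companion `OneDimensionalHardCoreBands` —
`|B_M(N)| ≤ 8e √N √(2M+1)` for all `N`, `M`, `L` (`abs_bandOccupation_le_sqrt`), where
`B_M(N) = ∑_{|m| ≤ M} c_m(N)` is the occupation of the `2M+1` lowest plane-wave modes of
Girardeau's ground state of `N` impenetrable bosons on a ring — was drawn there for bands of `o(N)`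
modes (`tendsto_bandOccupation_div`).  The van den Berg–Lewis–Pulé notion of **generalised
condensation** [cite: VandenbergLewisPule1986, Definition of generalised condensation] is a DOUBLE
limit: a fraction `≥ c > 0` of the particles in the modes `|m| ≤ εN` (i.e. `|k| ≤ 2περ` along
`L = N/ρ`; a band of `Θ(N)` modes) for all large `N`, for EVERY `ε > 0`.  The same inequality
refutes it for the impenetrable ring gas: `B_{⌊εN⌋}(N) ≤ 8e √(2ε + 1/N) N` for all `N ≥ 1`
(`bandOccupation_floor_le`), so `B_{⌊εN⌋}(N)/N ≤ 8e√(3ε)` eventually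
(`eventually_bandOccupation_floor_div_le`), every prescribed fraction `δ > 0` is undershot by a
suitable `ε > 0` (`exists_eps_bandOccupation_floor_le`), and no `c > 0` works for all `ε > 0`
(`not_exists_generalisedCondensation`).  Physically `B_{εN}(N)/N → (2/π)^{1/2}ρ_∞·√(2ε)·(1 + o(1))`-type
laws follow from `c_m(N) ∼ ρ_∞√(πN/m)` [cite: ForresterEtAl2003, §2.2.2]; only the vanishing as
`ε ↓ 0` is typed.

## References

* [VandenbergLewisPule1986] M. van den Berg, J. T. Lewis, J. V. Pulé, *A general theory of
  Bose–Einstein condensation*, Helv. Phys. Acta 59 (1986) 1271–1288 (generalised condensation as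
  the double limit over momentum shells; cited for the definition only, not re-read).
* [ForresterEtAl2003] P. J. Forrester, N. E. Frankel, T. M. Garoni, N. S. Witte, Phys. Rev. A 67
  (2003) 043607, arXiv:cond-mat/0211126: §2.2.2 (`c_n(N) ∝ √N`).
-/

noncomputable section

open MeasureTheory Filter Topology Finset
open scoped BigOperators Real

namespace Literature.Barriers.AtomisticToContinuum.BoseGas

variable {L : ℝ}

/-- **Band law for bands of `Θ(N)` modes.** For every `ε ≥ 0` and `N ≥ 1`, the `2⌊εN⌋+1` lowest
plane-wave modes of Girardeau's ground state carry at most `8e √(2ε + 1/N) · N` particles.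
[cite: ForresterEtAl2003, §2.2.2] -/
theorem bandOccupation_floor_le (hL : 0 < L) {ε : ℝ} (hε : 0 ≤ ε) {N : ℕ} (hN : 1 ≤ N) :
    bandOccupation N L ⌊ε * N⌋₊ ≤ 8 * Real.exp 1 * Real.sqrt (2 * ε + 1 / N) * N := by
  have hNpos : (0 : ℝ) < N := by exact_mod_cast hN
  have hfloor : ((⌊ε * N⌋₊ : ℕ) : ℝ) ≤ ε * N := Nat.floor_le (by positivity)
  have hband : (2 * ((⌊ε * N⌋₊ : ℕ) : ℝ) + 1) ≤ N * (2 * ε + 1 / N) := by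
    have : (N : ℝ) * (2 * ε + 1 / N) = 2 * (ε * N) + 1 := by field_simp
    rw [this]
    linarith
  have hsqrt : Real.sqrt (2 * ((⌊ε * N⌋₊ : ℕ) : ℝ) + 1) ≤
      Real.sqrt N * Real.sqrt (2 * ε + 1 / N) := by
    rw [← Real.sqrt_mul hNpos.le]
    exact Real.sqrt_le_sqrt hband
  calc bandOccupation N L ⌊ε * N⌋₊
      ≤ 8 * Real.exp 1 * Real.sqrt N * Real.sqrt (2 * ((⌊ε * N⌋₊ : ℕ) : ℝ) + 1) :=
        bandOccupation_le_sqrt N _ hL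
    _ ≤ 8 * Real.exp 1 * Real.sqrt N * (Real.sqrt N * Real.sqrt (2 * ε + 1 / N)) := by
        gcongr
    _ = 8 * Real.exp 1 * Real.sqrt (2 * ε + 1 / N) * N := by
        have h := Real.mul_self_sqrt hNpos.le
        calc 8 * Real.exp 1 * Real.sqrt N * (Real.sqrt N * Real.sqrt (2 * ε + 1 / N))
            = 8 * Real.exp 1 * Real.sqrt (2 * ε + 1 / N) * (Real.sqrt N * Real.sqrt N) := by ring
          _ = 8 * Real.exp 1 * Real.sqrt (2 * ε + 1 / N) * N := by rw [h]

/-- **The double-limit form.** For every `ε > 0`, eventually in `N` the fraction of particles in the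
modes `|m| ≤ εN` is at most `8e√(3ε)`: `B_{⌊εN⌋}(N)/N ≤ 8e √(3ε)` for `N ≥ 1/ε`.
[cite: ForresterEtAl2003, §2.2.2] -/
theorem eventually_bandOccupation_floor_div_le (hL : 0 < L) {ε : ℝ} (hε : 0 < ε) :
    ∀ᶠ N : ℕ in atTop, bandOccupation N L ⌊ε * N⌋₊ / N ≤ 8 * Real.exp 1 * Real.sqrt (3 * ε) := by
  filter_upwards [Filter.eventually_ge_atTop 1, Filter.eventually_ge_atTop ⌈1 / ε⌉₊] with N hN1 hNε
  have hNpos : (0 : ℝ) < N := by exact_mod_cast hN1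
  have hinv : 1 / (N : ℝ) ≤ ε := by
    have hle : 1 / ε ≤ (N : ℝ) := (Nat.le_ceil (1 / ε)).trans (by exact_mod_cast hNε)
    rw [div_le_iff₀ hNpos]
    calc (1 : ℝ) = 1 / ε * ε := by field_simp
      _ ≤ N * ε := by gcongr
      _ = ε * N := by ring
  rw [div_le_iff₀ hNpos]
  calc bandOccupation N L ⌊ε * N⌋₊
      ≤ 8 * Real.exp 1 * Real.sqrt (2 * ε + 1 / N) * N := bandOccupation_floor_le hL hε.le hN1
    _ ≤ 8 * Real.exp 1 * Real.sqrt (3 * ε) * N := by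
        gcongr
        linarith

/-- **Every prescribed fraction is undershot.** For every `δ > 0` there is `ε > 0` such that the
modes `|m| ≤ εN` eventually carry at most `δN` particles (`ε = (δ/8e)²/3`).
[cite: ForresterEtAl2003, §2.2.2] -/
theorem exists_eps_bandOccupation_floor_le (hL : 0 < L) {δ : ℝ} (hδ : 0 < δ) :
    ∃ ε : ℝ, 0 < ε ∧ ∀ᶠ N : ℕ in atTop, bandOccupation N L ⌊ε * N⌋₊ ≤ δ * N := by
  have he : 0 < 8 * Real.exp 1 := by positivity
  refine ⟨(δ / (8 * Real.exp 1)) ^ 2 / 3, by positivity, ?_⟩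
  have hsq : Real.sqrt (3 * ((δ / (8 * Real.exp 1)) ^ 2 / 3)) = δ / (8 * Real.exp 1) := by
    rw [show 3 * ((δ / (8 * Real.exp 1)) ^ 2 / 3) = (δ / (8 * Real.exp 1)) ^ 2 by ring]
    exact Real.sqrt_sq (by positivity)
  filter_upwards [eventually_bandOccupation_floor_div_le hL
      (by positivity : (0 : ℝ) < (δ / (8 * Real.exp 1)) ^ 2 / 3),
    Filter.eventually_ge_atTop 1] with N hN hN1
  have hNpos : (0 : ℝ) < N := by exact_mod_cast hN1
  rw [hsq, div_le_iff₀ hNpos] at hN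
  calc bandOccupation N L ⌊(δ / (8 * Real.exp 1)) ^ 2 / 3 * N⌋₊
      ≤ 8 * Real.exp 1 * (δ / (8 * Real.exp 1)) * N := hN
    _ = δ * N := by field_simp

/-- **No generalised condensation of van den Berg–Lewis–Pulé type in Girardeau's gas**: there is no
`c > 0` such that for EVERY `ε > 0` the modes `|m| ≤ εN` carry `≥ cN` particles for all large `N`
(types I, II and III of the vdBLP classification alike, all being special cases of this double
limit). [cite: VandenbergLewisPule1986, Definition of generalised condensation]
[cite: ForresterEtAl2003, §2.2.2] -/
theorem not_exists_generalisedCondensation (hL : 0 < L) :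
    ¬ ∃ c : ℝ, 0 < c ∧ ∀ ε : ℝ, 0 < ε →
      ∀ᶠ N : ℕ in atTop, c * N ≤ bandOccupation N L ⌊ε * N⌋₊ := by
  rintro ⟨c, hc, hall⟩
  obtain ⟨ε, hε, hev⟩ := exists_eps_bandOccupation_floor_le hL (half_pos hc)
  obtain ⟨N, hN⟩ := ((hall ε hε).and (hev.and (Filter.eventually_ge_atTop 1))).exists
  obtain ⟨h1, h2, h3⟩ := hN
  have hNpos : (0 : ℝ) < N := by exact_mod_cast h3
  have : c * N ≤ c / 2 * N := h1.trans h2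
  nlinarith

end Literature.Barriers.AtomisticToContinuum.BoseGas

end
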